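import Summits.QuantumAdvantage.QuantumAdvantage.Theorems.RandomOracleGaugeDecoupledCoreAAL1FamilyPoincare
import Literature.Analysis.Approximation.MarkovInequality
import Literature.Computability.QuantumComplexity.Symmetrization
import Mathlib.Analysis.Calculus.MeanValue
import Mathlib.Analysis.Calculus.Deriv.Polynomial
import HarnessLib

/-!
# Crux `PseudoBoundedAA` (stmt-QuantumAdvantage-15237) / `AAConj` (10748) — the SYMMETRIC CORNER, part 1/2:
# variance bookkeeping, Minsky–Papert for weight-symmetric polynomials, the Ehlich–Zeller/Markov mesh bound

Toolkit for `…SymmetricCorner` (part 2/2), which proves the Aaronson–Ambainis conjecture on the symmetric corner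
(`maxInf ≥ Var²/d⁴` for `[0,1]`-bounded weight-symmetric polynomials of degree `≤ d`):

* §1 `boolVariance_le_boolAvg_sq_sub` (`Var ≤ E(p − c)²`), `boolVariance_le_quarter`, `boolAvg_weight_sub_half_sq`
  (`E(|x| − n/2)² = n/4`, the centred weight is a sum of `n` orthogonal `±1/2`'s), `exists_influence_ge_avg`
  (`∃ i, Inf_i ≥ 4Var/n`: Poincaré + pigeonhole).
* §2 `symPoly_eval_weight` — for weight-symmetric `p` (cube values depend only on `|x|`), `p(x) = P(|x|)` with
  `P = symPoly n p` of degree `≤ deg p` (Minsky–Papert, tree `choose_mul_symPoly_eval`); `symPoly_eval_nat_mem`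
  (`P(k) ∈ [0,1]` for integers `k ≤ n`).
* §3 `abs_symPoly_le_two` — MESH-TO-INTERVAL: if `deg P ≤ d`, `|P(k)| ≤ 1` for integers `0 ≤ k ≤ n` and `4d² ≤ n`,
  then `|P| ≤ 2` on all of `[0,n]` (each point is within `1` of an integer; Markov `|P'| ≤ 2d²M/n ≤ M/2` on `[0,n]`;
  bootstrap `M ≤ 1 + M/2`).

Honest label: support lemmas; no stub, crux or summit is proved.  Sources: Beals et al. 2001 Lemma 3.2 (Minsky–Papert
symmetrization); Ehlich–Zeller 1964 / Rivlin–Cheney 1966 (mesh argument); Korneichuk 1991 Thm 3.5.8 (Markov).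
-/

-- D-0017: single-conjunct summit ⇒ the duplicate `QuantumAdvantage.QuantumAdvantage` is mandated.
set_option linter.dupNamespace false

noncomputable section

open Finset
open Literature.Computability.QuantumComplexity
open Literature.Analysis.Approximation (markov_inequality_Icc)
open Summit.QuantumAdvantage.QuantumAdvantage.Cruxes.DecoupledCoreAA.L1Family.Poincare
  (boolVariance_eq_sq_sub four_mul_sq_sub_le_sum_influence)

namespace Summit.QuantumAdvantage.QuantumAdvantage.Theorems.SosSandwich.SymmetricCorner

variable {N : ℕ}

/-! ### §1 Variance bookkeeping: `Var ≤ E(p − c)²`, `E(|x| − n/2)² = n/4`, `∃ i, Inf_i ≥ 4 Var/n` -/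

/-- `boolAvg` is linear: average of a pointwise combination `a·f + b·g + c`. [folklore] -/
theorem boolAvg_affine (f g : (Fin N → Bool) → ℝ) (a b c : ℝ) :
    boolAvg (fun x => a * f x + b * g x + c) = a * boolAvg f + b * boolAvg g + c := by
  unfold boolAvg
  have h2N : (2 : ℝ) ^ N ≠ 0 := by positivity
  rw [Finset.sum_add_distrib, Finset.sum_add_distrib, ← Finset.mul_sum, ← Finset.mul_sum, Finset.sum_const,
    Finset.card_univ, Fintype.card_fun, Fintype.card_bool, Fintype.card_fin, nsmul_eq_mul]
  push_cast
  field_simp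

/-- **`Var[p] ≤ E(p − c)²`** for every constant `c` (`E(p − c)² = Var[p] + (E p − c)²`). [folklore] -/
theorem boolVariance_le_boolAvg_sq_sub (p : MvPolynomial (Fin N) ℝ) (c : ℝ) :
    boolVariance p ≤ boolAvg (fun x => (evalBool p x - c) ^ 2) := by
  have hexp : (fun x => (evalBool p x - c) ^ 2) =
      fun x => 1 * (evalBool p x ^ 2) + (-2 * c) * evalBool p x + c ^ 2 := by
    funext x; ring
  rw [hexp, boolAvg_affine, boolVariance_eq_sq_sub]
  have : boolAvg (fun x => evalBool p x) = boolAvg (evalBool p) := rfl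
  rw [this]
  nlinarith [sq_nonneg (boolAvg (evalBool p) - c)]

/-- The variance of a `[0,1]`-valued cube function is at most `1/4`. [folklore] -/
theorem boolVariance_le_quarter {p : MvPolynomial (Fin N) ℝ} (hb : ∀ x, 0 ≤ evalBool p x ∧ evalBool p x ≤ 1) :
    boolVariance p ≤ 1 / 4 := by
  refine (boolVariance_le_boolAvg_sq_sub p (1 / 2)).trans ?_
  have h : ∀ x, (evalBool p x - 1 / 2) ^ 2 ≤ 1 / 4 := by
    intro x
    have := hb x
    nlinarith [this.1, this.2]
  calc boolAvg (fun x => (evalBool p x - 1 / 2) ^ 2) ≤ boolAvg (fun _ : Fin N → Bool => (1 / 4 : ℝ)) := by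
        unfold boolAvg
        exact div_le_div_of_nonneg_right (Finset.sum_le_sum fun x _ => h x) (by positivity)
    _ = 1 / 4 := boolAvg_const _

/-- The weight as a real sum of indicators: `|x| = Σ_k 1[x_k]`. [folklore] -/
theorem weight_eq_sum (x : Fin N → Bool) :
    (((Finset.univ.filter fun k => x k = true).card : ℕ) : ℝ) = ∑ k, (if x k then (1 : ℝ) else 0) := by
  rw [Finset.card_filter]
  push_cast
  rfl

/-- **`E_x (|x| − n/2)² = n/4`** (the centred weight is a sum of `n` orthogonal `±1/2`'s). [folklore] -/
theorem boolAvg_weight_sub_half_sq :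
    boolAvg (fun x : Fin N → Bool =>
      ((((Finset.univ.filter fun k => x k = true).card : ℕ) : ℝ) - N / 2) ^ 2) = N / 4 := by
  classical
  set c : Fin N → (Fin N → Bool) → ℝ := fun k x => (if x k then (1 : ℝ) else 0) - 1 / 2 with hc
  have hcent : ∀ x : Fin N → Bool, (((Finset.univ.filter fun k => x k = true).card : ℕ) : ℝ) - N / 2 = ∑ k, c k x := by
    intro x
    rw [weight_eq_sum, hc]
    simp only [Finset.sum_sub_distrib, Finset.sum_const, Finset.card_univ, Fintype.card_fin, nsmul_eq_mul]
    ring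
  have hcsq : ∀ k (x : Fin N → Bool), c k x * c k x = 1 / 4 := by
    intro k x; rw [hc]
    rcases Bool.eq_false_or_eq_true (x k) with hx | hx <;> simp [hx] <;> norm_num
  have hflip : ∀ k l, k ≠ l → ∀ x : Fin N → Bool, c k (flipBit k x) * c l (flipBit k x) = -(c k x * c l x) := by
    intro k l hkl x
    have h1 : c k (flipBit k x) = -c k x := by
      rw [hc]; simp only [flipBit, Function.update_self]; cases x k <;> norm_num
    have h2 : c l (flipBit k x) = c l x := by
      rw [hc]; simp only [flipBit, Function.update_of_ne hkl.symm]
    rw [h1, h2]; ring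
  have hoff : ∀ k l, k ≠ l → ∑ x : Fin N → Bool, c k x * c l x = 0 := by
    intro k l hkl
    have h := sum_flipBit k (fun x => c k x * c l x)
    simp_rw [hflip k l hkl] at h
    rw [Finset.sum_neg_distrib] at h
    linarith
  unfold boolAvg
  simp_rw [hcent, sq, Finset.sum_mul_sum]
  rw [Finset.sum_comm]
  have hinner : ∀ k, ∑ x : Fin N → Bool, ∑ l, c k x * c l x = (2 : ℝ) ^ N / 4 := by
    intro k
    rw [Finset.sum_comm]
    rw [Finset.sum_eq_single k]
    · simp_rw [hcsq]
      rw [Finset.sum_const, Finset.card_univ, Fintype.card_fun, Fintype.card_bool, Fintype.card_fin, nsmul_eq_mul]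
      push_cast; ring
    · intro l _ hlk
      exact hoff k l (Ne.symm hlk)
    · intro h; exact absurd (Finset.mem_univ k) h
  simp_rw [hinner]
  rw [Finset.sum_const, Finset.card_univ, Fintype.card_fin, nsmul_eq_mul]
  have h2N : (2 : ℝ) ^ N ≠ 0 := by positivity
  field_simp

/-- **Poincaré + pigeonhole**: a polynomial on `n ≥ 1` bits has a variable with `Inf_i ≥ 4 Var/n`.
[cite: ODonnell2014, §2.3] -/
theorem exists_influence_ge_avg (hN : 0 < N) (p : MvPolynomial (Fin N) ℝ) :
    ∃ i : Fin N, 4 * boolVariance p / N ≤ influence i p := by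
  classical
  have hP := four_mul_sq_sub_le_sum_influence p
  rw [← boolVariance_eq_sq_sub] at hP
  have hne : (Finset.univ : Finset (Fin N)).Nonempty := Finset.univ_nonempty_iff.mpr ⟨⟨0, hN⟩⟩
  obtain ⟨i, -, hi⟩ := Finset.exists_max_image Finset.univ (fun j => influence j p) hne
  refine ⟨i, ?_⟩
  have hsum : ∑ j, influence j p ≤ (N : ℝ) * influence i p := by
    calc ∑ j, influence j p ≤ ∑ _j : Fin N, influence i p := Finset.sum_le_sum fun j _ => hi j (Finset.mem_univ _)
      _ = (N : ℝ) * influence i p := by simp [Finset.sum_const, Finset.card_univ, Fintype.card_fin]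
  have hN0 : (0 : ℝ) < (N : ℝ) := by exact_mod_cast hN
  rw [div_le_iff₀ hN0]
  linarith [mul_comm (influence i p) (N : ℝ)]

/-! ### §2 Minsky–Papert: a weight-symmetric `p` is a univariate polynomial of the weight -/

/-- The indicator point of a `k`-set has Hamming weight `k`. [folklore] -/
theorem card_filter_decide_mem (S : Finset (Fin N)) :
    (Finset.univ.filter fun k => decide (k ∈ S) = true).card = S.card := by
  congr 1
  ext k
  simp

/-- Evaluation at the indicator vector of `S` is the cube value at the indicator point of `S`. [folklore] -/
theorem eval_indicatorVec_eq_evalBool (p : MvPolynomial (Fin N) ℝ) (S : Finset (Fin N)) :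
    MvPolynomial.eval (indicatorVec S) p = evalBool p (fun k => decide (k ∈ S)) := by
  have hv : (indicatorVec S : Fin N → ℝ) = fun i => if (fun k => decide (k ∈ S)) i = true then (1 : ℝ) else 0 := by
    funext k
    by_cases h : k ∈ S <;> simp [indicatorVec, h]
  unfold evalBool
  rw [← hv]

/-- **Minsky–Papert for a weight-symmetric polynomial**: `p(x) = P(|x|)` with `P = symPoly n p` (of degree
`≤ deg p`). [cite: BealsEtAl2001, Lemma 3.2] -/
theorem symPoly_eval_weight (p : MvPolynomial (Fin N) ℝ)
    (hsym : ∀ x x' : Fin N → Bool,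
      (Finset.univ.filter fun k => x k = true).card = (Finset.univ.filter fun k => x' k = true).card →
        evalBool p x = evalBool p x') (x : Fin N → Bool) :
    (symPoly N p).eval (((Finset.univ.filter fun k => x k = true).card : ℕ) : ℝ) = evalBool p x := by
  classical
  have h := choose_mul_symPoly_eval p ((Finset.univ.filter fun k => x k = true).card)
  have hterm : ∀ S ∈ Finset.univ.powersetCard ((Finset.univ.filter fun k => x k = true).card),
      MvPolynomial.eval (indicatorVec S) p = evalBool p x := by
    intro S hS
    rw [eval_indicatorVec_eq_evalBool]
    apply hsym
    rw [card_filter_decide_mem]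
    exact (Finset.mem_powersetCard.mp hS).2
  rw [Finset.sum_congr rfl hterm, Finset.sum_const, Finset.card_powersetCard, Finset.card_univ, Fintype.card_fin,
    nsmul_eq_mul] at h
  have hle : (Finset.univ.filter fun k => x k = true).card ≤ N :=
    (Finset.card_filter_le _ _).trans (by simp)
  have hpos : (0 : ℝ) < (N.choose ((Finset.univ.filter fun k => x k = true).card) : ℝ) := by
    exact_mod_cast Nat.choose_pos hle
  exact mul_left_cancel₀ hpos.ne' h

/-- Integer points of `[0,n]` are weights: `P(k) ∈ [0,1]` for `k ≤ n` when `p` is `[0,1]`-valued and weight-symmetric.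
[cite: BealsEtAl2001, Lemma 3.2] -/
theorem symPoly_eval_nat_mem (p : MvPolynomial (Fin N) ℝ)
    (hsym : ∀ x x' : Fin N → Bool,
      (Finset.univ.filter fun k => x k = true).card = (Finset.univ.filter fun k => x' k = true).card →
        evalBool p x = evalBool p x')
    (hb : ∀ x, 0 ≤ evalBool p x ∧ evalBool p x ≤ 1) {k : ℕ} (hk : k ≤ N) :
    0 ≤ (symPoly N p).eval (k : ℝ) ∧ (symPoly N p).eval (k : ℝ) ≤ 1 := by
  classical
  -- a point of weight `k`: the indicator of any `k`-subset
  obtain ⟨S, hS⟩ := Finset.powersetCard_nonempty.mpr (show k ≤ (Finset.univ : Finset (Fin N)).card by simpa using hk)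
  have hcard : S.card = k := (Finset.mem_powersetCard.mp hS).2
  have hw : (Finset.univ.filter fun k => decide (k ∈ S) = true).card = k := by rw [card_filter_decide_mem, hcard]
  have h := symPoly_eval_weight p hsym (fun j => decide (j ∈ S))
  rw [hw] at h
  rw [h]
  exact hb _

/-! ### §3 Ehlich–Zeller/Markov: `|P| ≤ 2` on `[0,n]` when `4d² ≤ n`; hence `Var ≤ 4d⁴/n` -/

/-- **Mesh-to-interval bound.** If `P` has degree `≤ d`, `|P(k)| ≤ 1` at the integers `0 ≤ k ≤ n`, and `4d² ≤ n`,
then `|P| ≤ 2` on all of `[0,n]` (every point is within `1` of an integer; Markov on `[0,n]` gives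
`|P'| ≤ 2d²M/n ≤ M/2`; so `M ≤ 1 + M/2`). [cite: Korneichuk1991, Thm 3.5.8 (§3.5.4)] -/
theorem abs_symPoly_le_two {d n : ℕ} (P : Polynomial ℝ) (hP : P.natDegree ≤ d) (hn : 4 * d ^ 2 ≤ n) (hn0 : 0 < n)
    (hint : ∀ k : ℕ, k ≤ n → |P.eval (k : ℝ)| ≤ 1) :
    ∀ y ∈ Set.Icc (0 : ℝ) n, |P.eval y| ≤ 2 := by
  have hn0' : (0 : ℝ) < (n : ℝ) := by exact_mod_cast hn0
  -- the maximum of `|P|` on the compact interval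
  obtain ⟨x₀, hx₀, hmax⟩ := (isCompact_Icc : IsCompact (Set.Icc (0 : ℝ) n)).exists_isMaxOn
    ⟨0, Set.left_mem_Icc.mpr hn0'.le⟩ ((Polynomial.continuous P).abs.continuousOn)
  set M := |P.eval x₀| with hM
  have hMb : ∀ y ∈ Set.Icc (0 : ℝ) n, |P.eval y| ≤ M := fun y hy => hmax hy
  have hM0 : 0 ≤ M := abs_nonneg _
  -- Markov on `[0, n]`
  have hdeg : P.degree ≤ d := Polynomial.degree_le_of_natDegree_le hP
  have hderiv : ∀ y ∈ Set.Icc (0 : ℝ) n, |(Polynomial.derivative P).eval y| ≤ 2 * (d : ℝ) ^ 2 * M / n := by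
    intro y hy
    have := markov_inequality_Icc hdeg hn0' hMb hy
    simpa using this
  -- Lipschitz bound on the interval
  have hlip : ∀ x ∈ Set.Icc (0 : ℝ) n, ∀ y ∈ Set.Icc (0 : ℝ) n,
      |P.eval y - P.eval x| ≤ 2 * (d : ℝ) ^ 2 * M / n * |y - x| := by
    intro x hx y hy
    have h := Convex.norm_image_sub_le_of_norm_deriv_le (f := fun t => P.eval t) (s := Set.Icc (0 : ℝ) n)
      (fun t _ => (Polynomial.differentiable P).differentiableAt)
      (fun t ht => by rw [Polynomial.deriv]; exact hderiv t ht) (convex_Icc _ _) hx hy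
    simpa [Real.norm_eq_abs] using h
  -- nearest integer below `x₀`
  set k := ⌊x₀⌋₊ with hk
  have hx0 : 0 ≤ x₀ := hx₀.1
  have hkle : (k : ℝ) ≤ x₀ := Nat.floor_le hx0
  have hklt : x₀ < (k : ℝ) + 1 := Nat.lt_floor_add_one x₀
  have hkn : k ≤ n := Nat.floor_le_of_le hx₀.2
  have hkI : (k : ℝ) ∈ Set.Icc (0 : ℝ) n := ⟨by positivity, by exact_mod_cast hkn⟩
  have h1 := hlip (k : ℝ) hkI x₀ hx₀
  have hdist : |x₀ - k| ≤ 1 := by rw [abs_of_nonneg (by linarith)]; linarith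
  have hPk := hint k hkn
  -- bootstrap: `M ≤ 1 + 2d²M/n ≤ 1 + M/2`
  have hcoef : 2 * (d : ℝ) ^ 2 * M / n ≤ M / 2 := by
    rw [div_le_iff₀ hn0']
    have : (4 : ℝ) * (d : ℝ) ^ 2 ≤ n := by exact_mod_cast hn
    nlinarith
  have hM2 : M ≤ 2 := by
    have hsub : |P.eval x₀| ≤ |P.eval (k : ℝ)| + |P.eval x₀ - P.eval (k : ℝ)| := by
      have := abs_add_le (P.eval (k : ℝ)) (P.eval x₀ - P.eval (k : ℝ))
      rwa [add_sub_cancel] at this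
    have hprod : 2 * (d : ℝ) ^ 2 * M / n * |x₀ - k| ≤ M / 2 := by
      calc 2 * (d : ℝ) ^ 2 * M / n * |x₀ - k| ≤ 2 * (d : ℝ) ^ 2 * M / n * 1 :=
            mul_le_mul_of_nonneg_left hdist (by positivity)
        _ ≤ M / 2 := by linarith
    linarith [hsub, h1, hprod, hPk]
  intro y hy
  exact (hMb y hy).trans hM2

end Summit.QuantumAdvantage.QuantumAdvantage.Theorems.SosSandwich.SymmetricCorner

end
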